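/-
Copyright: width seat `ym-line-sll-p2` (prover-ym-line-sll-p2-g2-0), route `SoftLoopLongLag`, crux T′ `ColdBoxSoftLoopLagFloor`
(stmt-QuantumFields-24180), line `birth`, registered stub E1a `stub_innerFlatLagFloorG`, brick 7a (exponent bookkeeping, part 1).
-/
import Summits.QuantumFields.YangMills.Theorems.SoftLoopLongLagLoopTranslation
import Summits.QuantumFields.YangMills.Theorems.ColdBoxAllGroupsBoxFloorAllGroupsExponentsG

/-!
# Route `SoftLoopLongLag`, crux T′, stub E1a `stub_innerFlatLagFloorG`, brick E1a-7a «Exponents I»: the exponent window of the inner flat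
# lag floor — generic `eventually` reductions, monomial bookkeeping in `β^ε`, `β^a`, and the first two error terms

Pure real analysis (no measure theory): with `R = ⌈β^ε⌉`, `H = ⌈β^a⌉`, `n = #(timeZeroCube R) ≤ 216β^{3ε}`, the sibling's link radius
`m = 2η_β ≤ 106√2·β^{5a−1/2}` (`linkRadius_le`) and loop perimeter radius `t = 4Rm ≤ 848√2·β^{ε+5a−1/2}`, the sizes of the loop one-scale core
(`Theorems/SoftLoopLongLagInnerFlatLoopCore.lean`) are monomials: `M ≤ c_M β^{5ε+10a}`, `τ ≤ c_τ β^{6ε+15a−1/2}`, `K ≤ 3456Dβ^{7ε}`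
(`loopSizes_le`); a term `≤ Cβ^s` with `s + γ < 0` (resp. `≤ Cβ^s e^{−bβ^{a'}}`) is eventually `≤ β^{−γ}/6` (`eventually_le_rpow_div_six`,
`…_exp`); `4Rm ≤ 1/4`, `24R ≤ H`, `32 ≤ H` eventually; and the first two of the six error terms of the reduction
(`Theorems/SoftLoopLongLagInnerFlatReduction.lean`) are eventually `≤ β^{−a}/6`: the Dirichlet-vs-free inductance error (exponent `10ε − 4a`)
and the tilt `3M²(e^{2w} − 1)` (exponent `10ε + 39a − 1/2`; `4ε ≤ a ≤ 1/100`).  Part 2 (`…InnerFlatExponents2`) treats the other four.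
No sorry; no new definition; standard axioms.  HONEST LABEL: rung R2xi-G RECORD label (leaf `WeakCouplingRates.XiPow`, an UPPER bound on the
lattice mass gap); NOT the Clay mass gap; no summit statement is touched.
-/

set_option autoImplicit false

noncomputable section

open MeasureTheory ProbabilityTheory Finset Real Filter Topology Metric
open Literature.Probability.LatticeModels (Site)
open Literature.MathematicalPhysics.QuantumLattice
open scoped Matrix.Norms.Frobenius
open Literature.MathematicalPhysics.QuantumFieldTheory (LatticeRep IsCompactSimpleLieGroup)
open Literature.MathematicalPhysics.QuantumFieldTheory.LatticeMaxwell
open Literature.MathematicalPhysics.QuantumFieldTheory.AxialGauge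
open Summit.QuantumFields.YangMills.Theorems.WeakCouplingRates
open Summit.QuantumFields.YangMills.Theorems.FreeEnergyLogCoefficient
open Summit.QuantumFields.YangMills.Theorems.ColdBoxAllGroups

namespace Summit.QuantumFields.YangMills.Theorems.SoftLoopLongLag

/-! ## §1 Two `eventually` reductions to the precision `β^{−γ}/6` -/

/-- A term bounded by `C·β^s` with `s + γ < 0` is eventually `≤ β^{−γ}/6`. -/
theorem eventually_le_rpow_div_six {γ s C : ℝ} {f : ℝ → ℝ} (hs : s + γ < 0)
    (hf : ∀ β : ℝ, 1 ≤ β → f β ≤ C * β ^ s) : ∀ᶠ β : ℝ in atTop, f β ≤ β ^ (-γ) / 6 := by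
  have ht := tendsto_const_mul_rpow_of_neg (6 * C) (s := -(s + γ)) (by linarith)
  filter_upwards [eventually_le_one_of_tendsto_zero ht, eventually_ge_atTop (1 : ℝ)] with β hg hβ
  have hβ0 : 0 < β := by linarith
  have hX : 0 ≤ β ^ (-γ) / 6 := by positivity
  have e : C * β ^ s = (6 * C * β ^ (-(-(s + γ)))) * (β ^ (-γ) / 6) := by
    rw [neg_neg, show 6 * C * β ^ (s + γ) * (β ^ (-γ) / 6) = C * (β ^ (s + γ) * β ^ (-γ)) by ring, ← Real.rpow_add hβ0]
    congr 2; ring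
  calc f β ≤ C * β ^ s := hf β hβ
    _ = (6 * C * β ^ (-(-(s + γ)))) * (β ^ (-γ) / 6) := e
    _ ≤ 1 * (β ^ (-γ) / 6) := mul_le_mul_of_nonneg_right hg hX
    _ = β ^ (-γ) / 6 := one_mul _

/-- A term bounded by `C·β^s·e^{−bβ^a}` (`a, b > 0`) is eventually `≤ β^{−γ}/6`. -/
theorem eventually_le_rpow_div_six_exp {γ s a b C : ℝ} {f : ℝ → ℝ} (ha : 0 < a) (hb : 0 < b)
    (hf : ∀ β : ℝ, 1 ≤ β → f β ≤ C * β ^ s * Real.exp (-(b * β ^ a))) : ∀ᶠ β : ℝ in atTop, f β ≤ β ^ (-γ) / 6 := by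
  have ht := tendsto_const_mul_rpow_mul_exp_neg (6 * C) (s + γ) ha hb
  filter_upwards [eventually_le_one_of_tendsto_zero ht, eventually_ge_atTop (1 : ℝ)] with β hg hβ
  have hβ0 : 0 < β := by linarith
  have hX : 0 ≤ β ^ (-γ) / 6 := by positivity
  have e : C * β ^ s * Real.exp (-(b * β ^ a)) = (6 * C * β ^ (s + γ) * Real.exp (-(b * β ^ a))) * (β ^ (-γ) / 6) := by
    have : β ^ s = β ^ (s + γ) * β ^ (-γ) := by rw [← Real.rpow_add hβ0]; congr 1; ring
    rw [this]; ring
  calc f β ≤ C * β ^ s * Real.exp (-(b * β ^ a)) := hf β hβ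
    _ = (6 * C * β ^ (s + γ) * Real.exp (-(b * β ^ a))) * (β ^ (-γ) / 6) := e
    _ ≤ 1 * (β ^ (-γ) / 6) := mul_le_mul_of_nonneg_right hg hX
    _ = β ^ (-γ) / 6 := one_mul _

/-! ## §2 Monomial bookkeeping (`β ≥ 1`, `0 < ε`, `0 < a`) -/

/-- The loop side: `1 ≤ R`, `R ≤ 2β^ε`, `R⁴ ≤ 16β^{4ε}`, `#(timeZeroCube R) ≤ 216β^{3ε}` for `R = ⌈β^ε⌉`. -/
theorem loopSide_bounds {β ε : ℝ} (hβ : 1 ≤ β) (hε : 0 ≤ ε) :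
    (1 : ℝ) ≤ ⌈β ^ ε⌉₊ ∧ (⌈β ^ ε⌉₊ : ℝ) ≤ 2 * β ^ ε ∧ (⌈β ^ ε⌉₊ : ℝ) ^ 4 ≤ 16 * β ^ (4 * ε) ∧
      ((timeZeroCube ⌈β ^ ε⌉₊).card : ℝ) ≤ 216 * β ^ (3 * ε) := by
  have hβ0 : 0 ≤ β := by linarith
  obtain ⟨h1, h2⟩ := one_le_ceil_rpow_and_le (A := ε) hβ hε
  have h4 : (⌈β ^ ε⌉₊ : ℝ) ^ 4 ≤ 16 * β ^ (4 * ε) := by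
    calc (⌈β ^ ε⌉₊ : ℝ) ^ 4 ≤ (2 * β ^ ε) ^ 4 := pow_le_pow_left₀ (by positivity) h2 4
      _ = 16 * (β ^ ε) ^ 4 := by ring
      _ = 16 * β ^ (4 * ε) := by rw [rpow_theta_pow hβ0 4]; norm_num
  have hR1 : 1 ≤ ⌈β ^ ε⌉₊ := by exact_mod_cast h1
  have hc : ((timeZeroCube ⌈β ^ ε⌉₊).card : ℝ) ≤ 216 * β ^ (3 * ε) := by
    calc ((timeZeroCube ⌈β ^ ε⌉₊).card : ℝ) ≤ 27 * (⌈β ^ ε⌉₊ : ℝ) ^ 3 := card_timeZeroCube_le_real hR1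
      _ ≤ 27 * (2 * β ^ ε) ^ 3 := by gcongr
      _ = 216 * (β ^ ε) ^ 3 := by ring
      _ = 216 * β ^ (3 * ε) := by rw [rpow_theta_pow hβ0 3]; norm_num
  exact ⟨h1, h2, h4, hc⟩

/-- The box side: `β^a ≤ H` and `R⁴/H⁴ ≤ 16·β^{4ε−4a}` for `H = ⌈β^a⌉`, `R = ⌈β^ε⌉`. -/
theorem ratio_pow_four_le {β ε a : ℝ} (hβ : 1 ≤ β) (hε : 0 ≤ ε) :
    (⌈β ^ ε⌉₊ : ℝ) ^ 4 / (⌈β ^ a⌉₊ : ℝ) ^ 4 ≤ 16 * β ^ (4 * ε - 4 * a) := by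
  have hβ0 : 0 < β := by linarith
  have hR4 := (loopSide_bounds hβ hε).2.2.1
  have hHa : β ^ a ≤ (⌈β ^ a⌉₊ : ℝ) := Nat.le_ceil _
  have hya : 0 < β ^ a := Real.rpow_pos_of_pos hβ0 _
  have hH4 : β ^ (4 * a) ≤ (⌈β ^ a⌉₊ : ℝ) ^ 4 := by
    have := pow_le_pow_left₀ hya.le hHa 4
    rwa [rpow_theta_pow hβ0.le 4, show ((4 : ℕ) : ℝ) * a = 4 * a by norm_num] at this
  have h4a : 0 < β ^ (4 * a) := Real.rpow_pos_of_pos hβ0 _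
  rw [div_le_iff₀ (lt_of_lt_of_le h4a hH4)]
  calc (⌈β ^ ε⌉₊ : ℝ) ^ 4 ≤ 16 * β ^ (4 * ε) := hR4
    _ = 16 * β ^ (4 * ε - 4 * a) * β ^ (4 * a) := by rw [mul_assoc, ← Real.rpow_add hβ0]; congr 2; ring
    _ ≤ 16 * β ^ (4 * ε - 4 * a) * (⌈β ^ a⌉₊ : ℝ) ^ 4 := by gcongr

/-- The loop perimeter radius `t = 4Rm ≤ 848√2·β^{ε + (5a − 1/2)}` (`m` the link radius `2η_β` at `θ = a`). -/
theorem loopRadius_le {β ε a : ℝ} (hβ : 1 ≤ β) (hε : 0 ≤ ε) (ha : 0 ≤ a) :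
    4 * (⌈β ^ ε⌉₊ : ℝ) * (2 * ((12 * (⌈β ^ a⌉₊ : ℝ) ^ 2 + 2 * ⌈β ^ a⌉₊ + 1) * (Real.sqrt 2 * Real.sqrt (β ^ (2 * (3 * a) - 1))))) ≤
      8 * (106 * Real.sqrt 2) * β ^ (ε + (5 * a - 1 / 2)) := by
  have hβ0 : 0 < β := by linarith
  have hR := (loopSide_bounds hβ hε).2.1
  have hm := linkRadius_le hβ ha
  have hm0 := linkRadius_nonneg β a
  calc 4 * (⌈β ^ ε⌉₊ : ℝ) * (2 * ((12 * (⌈β ^ a⌉₊ : ℝ) ^ 2 + 2 * ⌈β ^ a⌉₊ + 1) * (Real.sqrt 2 * Real.sqrt (β ^ (2 * (3 * a) - 1)))))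
      ≤ 4 * (2 * β ^ ε) * (106 * Real.sqrt 2 * β ^ (5 * a - 1 / 2)) := by gcongr
    _ = 8 * (106 * Real.sqrt 2) * (β ^ ε * β ^ (5 * a - 1 / 2)) := by ring
    _ = _ := by rw [← Real.rpow_add hβ0]

/-- **The per-loop sizes** at `β ≥ 1`: with `n = #(timeZeroCube R)`, `t = 4Rm`, `κ = 848√2`:
`M = n(βt²/2 + 9βt³) ≤ c_M·β^{5ε+10a}`, `τ = n·9βt³ ≤ c_τ·β^{6ε+15a−1/2}`, `K = D·n·R⁴ ≤ 3456·D·β^{7ε}`,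
`c_M = (1/2 + 9κ)·216·κ²`, `c_τ = 9·216·κ³` (provided `ε + (5a − 1/2) ≤ 0`, so that `t ≤ κ`). -/
theorem loopSizes_le (D : ℕ) {β ε a : ℝ} (hβ : 1 ≤ β) (hε : 0 ≤ ε) (ha : 0 ≤ a) (hs : ε + (5 * a - 1 / 2) ≤ 0) :
    ((timeZeroCube ⌈β ^ ε⌉₊).card : ℝ) *
          (β * (4 * (⌈β ^ ε⌉₊ : ℝ) * (2 * ((12 * (⌈β ^ a⌉₊ : ℝ) ^ 2 + 2 * ⌈β ^ a⌉₊ + 1) *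
            (Real.sqrt 2 * Real.sqrt (β ^ (2 * (3 * a) - 1)))))) ^ 2 / 2 +
            9 * β * (4 * (⌈β ^ ε⌉₊ : ℝ) * (2 * ((12 * (⌈β ^ a⌉₊ : ℝ) ^ 2 + 2 * ⌈β ^ a⌉₊ + 1) *
              (Real.sqrt 2 * Real.sqrt (β ^ (2 * (3 * a) - 1)))))) ^ 3) ≤
        (1 / 2 + 9 * (8 * (106 * Real.sqrt 2))) * 216 * (8 * (106 * Real.sqrt 2)) ^ 2 * β ^ (5 * ε + 10 * a) ∧
      ((timeZeroCube ⌈β ^ ε⌉₊).card : ℝ) *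
          (9 * β * (4 * (⌈β ^ ε⌉₊ : ℝ) * (2 * ((12 * (⌈β ^ a⌉₊ : ℝ) ^ 2 + 2 * ⌈β ^ a⌉₊ + 1) *
            (Real.sqrt 2 * Real.sqrt (β ^ (2 * (3 * a) - 1)))))) ^ 3) ≤
        9 * 216 * (8 * (106 * Real.sqrt 2)) ^ 3 * β ^ (6 * ε + 15 * a - 1 / 2) ∧
      (D : ℝ) * ((timeZeroCube ⌈β ^ ε⌉₊).card : ℝ) * (⌈β ^ ε⌉₊ : ℝ) ^ 4 ≤ 3456 * D * β ^ (7 * ε) := by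
  have hβ0 : 0 < β := by linarith
  obtain ⟨-, -, hR4, hn⟩ := loopSide_bounds hβ hε
  set κ : ℝ := 8 * (106 * Real.sqrt 2) with hκ
  set t : ℝ := 4 * (⌈β ^ ε⌉₊ : ℝ) * (2 * ((12 * (⌈β ^ a⌉₊ : ℝ) ^ 2 + 2 * ⌈β ^ a⌉₊ + 1) *
    (Real.sqrt 2 * Real.sqrt (β ^ (2 * (3 * a) - 1))))) with ht
  set n : ℝ := ((timeZeroCube ⌈β ^ ε⌉₊).card : ℝ) with hn'
  have ht0 : 0 ≤ t := by rw [ht]; exact mul_nonneg (by positivity) (linkRadius_nonneg β a)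
  have htle : t ≤ κ * β ^ (ε + (5 * a - 1 / 2)) := loopRadius_le hβ hε ha
  have hts : β ^ (ε + (5 * a - 1 / 2)) ≤ 1 := Real.rpow_le_one_of_one_le_of_nonpos hβ hs
  have hκ0 : 0 ≤ κ := by positivity
  have htκ : t ≤ κ := htle.trans (by nlinarith)
  have hn0 : 0 ≤ n := Nat.cast_nonneg _
  -- `t² ≤ κ² β^{2s}`, `t³ ≤ κ³ β^{3s}`
  have e2 : (β ^ (ε + (5 * a - 1 / 2))) ^ 2 = β ^ (2 * ε + 10 * a - 1) := by
    rw [← Real.rpow_natCast, ← Real.rpow_mul hβ0.le]; congr 1; push_cast; ring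
  have e3 : (β ^ (ε + (5 * a - 1 / 2))) ^ 3 = β ^ (3 * ε + 15 * a - 3 / 2) := by
    rw [← Real.rpow_natCast, ← Real.rpow_mul hβ0.le]; congr 1; push_cast; ring
  have ht2 : t ^ 2 ≤ κ ^ 2 * β ^ (2 * ε + 10 * a - 1) := by
    calc t ^ 2 ≤ (κ * β ^ (ε + (5 * a - 1 / 2))) ^ 2 := pow_le_pow_left₀ ht0 htle 2
      _ = _ := by rw [mul_pow, e2]
  have ht3 : t ^ 3 ≤ κ ^ 3 * β ^ (3 * ε + 15 * a - 3 / 2) := by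
    calc t ^ 3 ≤ (κ * β ^ (ε + (5 * a - 1 / 2))) ^ 3 := pow_le_pow_left₀ ht0 htle 3
      _ = _ := by rw [mul_pow, e3]
  refine ⟨?_, ?_, ?_⟩
  · -- M
    have hpoly : β * t ^ 2 / 2 + 9 * β * t ^ 3 ≤ (1 / 2 + 9 * κ) * (β * t ^ 2) := by
      have : t ^ 3 ≤ κ * t ^ 2 := by nlinarith [sq_nonneg t]
      nlinarith
    have e : β ^ (3 * ε) * (β * β ^ (2 * ε + 10 * a - 1)) = β ^ (5 * ε + 10 * a) := by
      rw [show β * β ^ (2 * ε + 10 * a - 1) = β ^ (1 : ℝ) * β ^ (2 * ε + 10 * a - 1) by rw [Real.rpow_one],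
        ← Real.rpow_add hβ0, ← Real.rpow_add hβ0]
      congr 1; ring
    calc n * (β * t ^ 2 / 2 + 9 * β * t ^ 3) ≤ (216 * β ^ (3 * ε)) * ((1 / 2 + 9 * κ) * (β * (κ ^ 2 * β ^ (2 * ε + 10 * a - 1)))) := by
          refine mul_le_mul hn (hpoly.trans ?_) (by positivity) (by positivity)
          exact mul_le_mul_of_nonneg_left (mul_le_mul_of_nonneg_left ht2 hβ0.le) (by positivity)
      _ = (1 / 2 + 9 * κ) * 216 * κ ^ 2 * (β ^ (3 * ε) * (β * β ^ (2 * ε + 10 * a - 1))) := by ring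
      _ = _ := by rw [e]
  · -- τ
    have e : β ^ (3 * ε) * (β * β ^ (3 * ε + 15 * a - 3 / 2)) = β ^ (6 * ε + 15 * a - 1 / 2) := by
      rw [show β * β ^ (3 * ε + 15 * a - 3 / 2) = β ^ (1 : ℝ) * β ^ (3 * ε + 15 * a - 3 / 2) by rw [Real.rpow_one],
        ← Real.rpow_add hβ0, ← Real.rpow_add hβ0]
      congr 1; ring
    calc n * (9 * β * t ^ 3) ≤ (216 * β ^ (3 * ε)) * (9 * β * (κ ^ 3 * β ^ (3 * ε + 15 * a - 3 / 2))) := by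
          refine mul_le_mul hn ?_ (by positivity) (by positivity)
          exact mul_le_mul_of_nonneg_left ht3 (by positivity)
      _ = 9 * 216 * κ ^ 3 * (β ^ (3 * ε) * (β * β ^ (3 * ε + 15 * a - 3 / 2))) := by ring
      _ = _ := by rw [e]
  · -- K
    have hD : (0 : ℝ) ≤ D := Nat.cast_nonneg _
    calc (D : ℝ) * n * (⌈β ^ ε⌉₊ : ℝ) ^ 4 ≤ (D : ℝ) * (216 * β ^ (3 * ε)) * (16 * β ^ (4 * ε)) := by gcongr
      _ = 3456 * D * (β ^ (3 * ε) * β ^ (4 * ε)) := by ring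
      _ = 3456 * D * β ^ (7 * ε) := by rw [← Real.rpow_add hβ0]; ring_nf

/-! ## §3 The window and the six error terms, eventually -/

/-- **The loop radius is eventually small**: `4Rm ≤ 1/4` (exponent `ε + 5a − 1/2 < 0`). -/
theorem eventually_loopRadius_le {ε a : ℝ} (hε : 0 ≤ ε) (ha : 0 ≤ a) (hs : ε + (5 * a - 1 / 2) < 0) :
    ∀ᶠ β : ℝ in atTop,
      4 * (⌈β ^ ε⌉₊ : ℝ) * (2 * ((12 * (⌈β ^ a⌉₊ : ℝ) ^ 2 + 2 * ⌈β ^ a⌉₊ + 1) * (Real.sqrt 2 * Real.sqrt (β ^ (2 * (3 * a) - 1))))) ≤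
        1 / 4 := by
  have ht := tendsto_const_mul_rpow_of_neg (8 * (106 * Real.sqrt 2)) (s := -(ε + (5 * a - 1 / 2))) (by linarith)
  filter_upwards [ht.eventually (Iic_mem_nhds (by norm_num : (0 : ℝ) < 1 / 4)), eventually_ge_atTop (1 : ℝ)] with β hβ hβ1
  rw [neg_neg] at hβ
  exact (loopRadius_le hβ1 hε ha).trans hβ

/-- **The inner box is eventually deep**: `24R ≤ H` and `32 ≤ H` (`ε < a`). -/
theorem eventually_box_deep {ε a : ℝ} (hε : 0 ≤ ε) (hεa : ε < a) :
    ∀ᶠ β : ℝ in atTop, 24 * (⌈β ^ ε⌉₊ : ℝ) ≤ ⌈β ^ a⌉₊ ∧ (32 : ℝ) ≤ ⌈β ^ a⌉₊ := by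
  have ha : 0 < a := lt_of_le_of_lt hε hεa
  filter_upwards [(tendsto_rpow_atTop (by linarith : 0 < a - ε)).eventually_ge_atTop 48,
    (tendsto_rpow_atTop ha).eventually_ge_atTop 32, eventually_ge_atTop (1 : ℝ)] with β h48 h32 hβ
  have hβ0 : 0 < β := by linarith
  have hR := (loopSide_bounds hβ hε).2.1
  have hHa : β ^ a ≤ (⌈β ^ a⌉₊ : ℝ) := Nat.le_ceil _
  refine ⟨?_, h32.trans hHa⟩
  have hε0 : 0 < β ^ ε := Real.rpow_pos_of_pos hβ0 _
  have : 48 * β ^ ε ≤ β ^ a := by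
    calc 48 * β ^ ε ≤ β ^ (a - ε) * β ^ ε := mul_le_mul_of_nonneg_right h48 hε0.le
      _ = β ^ a := by rw [← Real.rpow_add hβ0]; ring_nf
  linarith

/-- **Error 1 (Dirichlet vs free inductances)**: `(D/2)·2(K R⁴/H⁴)(C n²) ≤ β^{−a}/6` eventually (`4ε ≤ a`). -/
theorem eventually_err1_le (D : ℕ) {K C ε a : ℝ} (hK : 0 ≤ K) (hC : 0 ≤ C) (hε : 0 < ε) (h4 : 4 * ε ≤ a) :
    ∀ᶠ β : ℝ in atTop,
      (D : ℝ) / 2 * (2 * (K * (⌈β ^ ε⌉₊ : ℝ) ^ 4 / (⌈β ^ a⌉₊ : ℝ) ^ 4) * (C * ((timeZeroCube ⌈β ^ ε⌉₊).card : ℝ) ^ 2)) ≤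
        β ^ (-a) / 6 := by
  have hD : (0 : ℝ) ≤ D := Nat.cast_nonneg _
  refine eventually_le_rpow_div_six (C := (D : ℝ) * K * C * 16 * 216 ^ 2) (s := 10 * ε - 4 * a) (by linarith) ?_
  intro β hβ
  have hβ0 : 0 < β := by linarith
  obtain ⟨-, -, -, hn⟩ := loopSide_bounds hβ hε.le
  have hr := ratio_pow_four_le (a := a) hβ hε.le
  have hn2 : ((timeZeroCube ⌈β ^ ε⌉₊).card : ℝ) ^ 2 ≤ 216 ^ 2 * β ^ (6 * ε) := by
    calc ((timeZeroCube ⌈β ^ ε⌉₊).card : ℝ) ^ 2 ≤ (216 * β ^ (3 * ε)) ^ 2 := pow_le_pow_left₀ (Nat.cast_nonneg _) hn 2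
      _ = 216 ^ 2 * (β ^ (3 * ε)) ^ 2 := by ring
      _ = 216 ^ 2 * β ^ (6 * ε) := by rw [← Real.rpow_natCast (β ^ (3 * ε)) 2, ← Real.rpow_mul hβ0.le]; ring_nf
  have e : β ^ (4 * ε - 4 * a) * β ^ (6 * ε) = β ^ (10 * ε - 4 * a) := by rw [← Real.rpow_add hβ0]; ring_nf
  calc (D : ℝ) / 2 * (2 * (K * (⌈β ^ ε⌉₊ : ℝ) ^ 4 / (⌈β ^ a⌉₊ : ℝ) ^ 4) * (C * ((timeZeroCube ⌈β ^ ε⌉₊).card : ℝ) ^ 2))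
      = (D : ℝ) * K * C * ((⌈β ^ ε⌉₊ : ℝ) ^ 4 / (⌈β ^ a⌉₊ : ℝ) ^ 4) * ((timeZeroCube ⌈β ^ ε⌉₊).card : ℝ) ^ 2 := by ring
    _ ≤ (D : ℝ) * K * C * (16 * β ^ (4 * ε - 4 * a)) * (216 ^ 2 * β ^ (6 * ε)) := by gcongr
    _ = (D : ℝ) * K * C * 16 * 216 ^ 2 * (β ^ (4 * ε - 4 * a) * β ^ (6 * ε)) := by ring
    _ = _ := by rw [e]

/-- **Error 2 (tilt)**: `3M²(e^{2w} − 1) ≤ β^{−a}/6` eventually, `w` the card form of the tilt size (`4ε ≤ a ≤ 1/100`). -/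
theorem eventually_err2_le {C₂ ε a : ℝ} (hC₂ : 0 ≤ C₂) (hε : 0 < ε) (h4 : 4 * ε ≤ a) (ha1 : a ≤ 1 / 100) :
    ∀ᶠ β : ℝ in atTop,
      3 * (((timeZeroCube ⌈β ^ ε⌉₊).card : ℝ) *
            (β * (4 * (⌈β ^ ε⌉₊ : ℝ) * (2 * ((12 * (⌈β ^ a⌉₊ : ℝ) ^ 2 + 2 * ⌈β ^ a⌉₊ + 1) *
              (Real.sqrt 2 * Real.sqrt (β ^ (2 * (3 * a) - 1)))))) ^ 2 / 2 +
              9 * β * (4 * (⌈β ^ ε⌉₊ : ℝ) * (2 * ((12 * (⌈β ^ a⌉₊ : ℝ) ^ 2 + 2 * ⌈β ^ a⌉₊ + 1) *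
                (Real.sqrt 2 * Real.sqrt (β ^ (2 * (3 * a) - 1)))))) ^ 3)) ^ 2 *
          (Real.exp (2 * (120 * (2 * (⌈β ^ a⌉₊ : ℝ) + 1) ^ 4 *
              (190 * β * (2 * ((12 * (⌈β ^ a⌉₊ : ℝ) ^ 2 + 2 * ⌈β ^ a⌉₊ + 1) * (Real.sqrt 2 * Real.sqrt (β ^ (2 * (3 * a) - 1))))) ^ 3) +
            4 * (2 * (⌈β ^ a⌉₊ : ℝ) + 1) ^ 4 *
              (2 * C₂ * (2 * ((12 * (⌈β ^ a⌉₊ : ℝ) ^ 2 + 2 * ⌈β ^ a⌉₊ + 1) * (Real.sqrt 2 * Real.sqrt (β ^ (2 * (3 * a) - 1))))) ^ 2))) - 1) ≤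
        β ^ (-a) / 6 := by
  have ha : 0 ≤ a := by linarith
  set cM : ℝ := (1 / 2 + 9 * (8 * (106 * Real.sqrt 2))) * 216 * (8 * (106 * Real.sqrt 2)) ^ 2 with hcM
  set A₁ : ℝ := 120 * 625 * 190 * (106 * Real.sqrt 2) ^ 3 with hA₁
  set A₂ : ℝ := 4 * 625 * (2 * C₂) * (106 * Real.sqrt 2) ^ 2 with hA₂
  have hA₁0 : 0 ≤ A₁ := by positivity
  have hA₂0 : 0 ≤ A₂ := by positivity
  have hcM0 : 0 ≤ cM := by positivity
  -- the two majorants and `w ≤ 1/2`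
  have h1 := eventually_le_rpow_div_six (γ := a) (C := 2 * (12 * cM ^ 2 * A₁)) (s := 10 * ε + 20 * a + (19 * a - 1 / 2))
    (f := fun β => 2 * (12 * cM ^ 2 * A₁ * β ^ (10 * ε + 20 * a + (19 * a - 1 / 2)))) (by linarith) (fun β _ => le_of_eq (by ring))
  have h2 := eventually_le_rpow_div_six (γ := a) (C := 2 * (12 * cM ^ 2 * A₂)) (s := 10 * ε + 20 * a + (14 * a - 1))
    (f := fun β => 2 * (12 * cM ^ 2 * A₂ * β ^ (10 * ε + 20 * a + (14 * a - 1)))) (by linarith) (fun β _ => le_of_eq (by ring))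
  have h3 := eventually_le_rpow_div_six (γ := a) (C := 4 * A₁) (s := 19 * a - 1 / 2)
    (f := fun β => 4 * (A₁ * β ^ (19 * a - 1 / 2))) (by linarith) (fun β _ => le_of_eq (by ring))
  have h4' := eventually_le_rpow_div_six (γ := a) (C := 4 * A₂) (s := 14 * a - 1)
    (f := fun β => 4 * (A₂ * β ^ (14 * a - 1))) (by linarith) (fun β _ => le_of_eq (by ring))
  filter_upwards [h1, h2, h3, h4', eventually_ge_atTop (1 : ℝ)] with β hβ1 hβ2 hβ3 hβ4 hβ
  have hβ0 : 0 < β := by linarith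
  have htar : β ^ (-a) / 6 ≤ 1 / 6 := by
    have : β ^ (-a) ≤ 1 := Real.rpow_le_one_of_one_le_of_nonpos hβ (by linarith)
    linarith
  set w : ℝ := 120 * (2 * (⌈β ^ a⌉₊ : ℝ) + 1) ^ 4 *
      (190 * β * (2 * ((12 * (⌈β ^ a⌉₊ : ℝ) ^ 2 + 2 * ⌈β ^ a⌉₊ + 1) * (Real.sqrt 2 * Real.sqrt (β ^ (2 * (3 * a) - 1))))) ^ 3) +
    4 * (2 * (⌈β ^ a⌉₊ : ℝ) + 1) ^ 4 *
      (2 * C₂ * (2 * ((12 * (⌈β ^ a⌉₊ : ℝ) ^ 2 + 2 * ⌈β ^ a⌉₊ + 1) * (Real.sqrt 2 * Real.sqrt (β ^ (2 * (3 * a) - 1))))) ^ 2) with hw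
  have hw0 : 0 ≤ w := by positivity
  have hwle : w ≤ A₁ * β ^ (19 * a - 1 / 2) + A₂ * β ^ (14 * a - 1) := tiltExponent_le hC₂ hβ ha
  have hwhalf : w ≤ 1 / 2 := by
    have : 4 * (A₁ * β ^ (19 * a - 1 / 2)) + 4 * (A₂ * β ^ (14 * a - 1)) ≤ 2 / 6 := by linarith
    linarith
  have hexp : Real.exp (2 * w) - 1 ≤ 4 * w := by
    have h := Real.abs_exp_sub_one_le (x := 2 * w) (by rw [abs_of_nonneg (by positivity)]; linarith)
    rw [abs_of_nonneg (by positivity : (0 : ℝ) ≤ 2 * w)] at h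
    linarith [le_abs_self (Real.exp (2 * w) - 1)]
  -- `M ≤ cM β^{5ε+10a}`
  have hs : ε + (5 * a - 1 / 2) ≤ 0 := by linarith
  have hM := (loopSizes_le 0 hβ hε.le ha hs).1
  set M : ℝ := ((timeZeroCube ⌈β ^ ε⌉₊).card : ℝ) *
      (β * (4 * (⌈β ^ ε⌉₊ : ℝ) * (2 * ((12 * (⌈β ^ a⌉₊ : ℝ) ^ 2 + 2 * ⌈β ^ a⌉₊ + 1) *
        (Real.sqrt 2 * Real.sqrt (β ^ (2 * (3 * a) - 1)))))) ^ 2 / 2 +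
        9 * β * (4 * (⌈β ^ ε⌉₊ : ℝ) * (2 * ((12 * (⌈β ^ a⌉₊ : ℝ) ^ 2 + 2 * ⌈β ^ a⌉₊ + 1) *
          (Real.sqrt 2 * Real.sqrt (β ^ (2 * (3 * a) - 1)))))) ^ 3) with hMdef
  have hM0 : 0 ≤ M := by
    rw [hMdef]; exact mul_nonneg (Nat.cast_nonneg _) (by positivity)
  have hM2 : M ^ 2 ≤ cM ^ 2 * β ^ (10 * ε + 20 * a) := by
    have e : (β ^ (5 * ε + 10 * a)) ^ 2 = β ^ (10 * ε + 20 * a) := by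
      rw [← Real.rpow_natCast, ← Real.rpow_mul hβ0.le]; congr 1; push_cast; ring
    rw [← hcM] at hM
    calc M ^ 2 ≤ (cM * β ^ (5 * ε + 10 * a)) ^ 2 := pow_le_pow_left₀ hM0 hM 2
      _ = _ := by rw [mul_pow, e]
  have e1 : β ^ (10 * ε + 20 * a) * β ^ (19 * a - 1 / 2) = β ^ (10 * ε + 20 * a + (19 * a - 1 / 2)) := by
    rw [← Real.rpow_add hβ0]
  have e2 : β ^ (10 * ε + 20 * a) * β ^ (14 * a - 1) = β ^ (10 * ε + 20 * a + (14 * a - 1)) := by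
    rw [← Real.rpow_add hβ0]
  have h3M : 0 ≤ 3 * M ^ 2 := by positivity
  calc 3 * M ^ 2 * (Real.exp (2 * w) - 1) ≤ 3 * M ^ 2 * (4 * w) := mul_le_mul_of_nonneg_left hexp h3M
    _ ≤ 3 * (cM ^ 2 * β ^ (10 * ε + 20 * a)) * (4 * (A₁ * β ^ (19 * a - 1 / 2) + A₂ * β ^ (14 * a - 1))) := by
        gcongr
    _ = 12 * cM ^ 2 * A₁ * (β ^ (10 * ε + 20 * a) * β ^ (19 * a - 1 / 2)) +
          12 * cM ^ 2 * A₂ * (β ^ (10 * ε + 20 * a) * β ^ (14 * a - 1)) := by ring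
    _ = 12 * cM ^ 2 * A₁ * β ^ (10 * ε + 20 * a + (19 * a - 1 / 2)) + 12 * cM ^ 2 * A₂ * β ^ (10 * ε + 20 * a + (14 * a - 1)) := by
        rw [e1, e2]
    _ ≤ β ^ (-a) / 6 := by linarith

end Summit.QuantumFields.YangMills.Theorems.SoftLoopLongLag

end
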